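import Mathlib

/-!
# ζ(5) search — an algebraic residue theorem: the residues of `A / ∏ (X − a_i)^{m_i}` (`m_i ≤ 2`) sum to zero when `deg A ≤ deg B − 2`

HONEST FRAMING: systematic search; no irrationality claim unless certified.

Cell `pub-zeta5`, prover seat p3 (gen 2).  PROOF LAYER (no new statements about ζ(5)): a self-contained, purely algebraic
"sum of residues = 0" over an arbitrary field `K`, in exactly the polynomial form needed to discharge gen-2 g11's finite-field
`@[conjecture] ResidueLaw.ResidueIdentity` (tree `Zeta5Search/ResidueLaw.lean`, REPORT-gen2-g11 §2).

Setting: a finite index set `s`, points `a i ∈ K` injective on `s`, multiplicities `m i ∈ {1, 2}`, `B = ∏_{i∈s} (X − a_i)^{m_i}`,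
`n = deg B = Σ m_i`, cofactors `C_i = B / (X − a_i)^{m_i}` (`cofactor`).  For a polynomial `A` the RESIDUE of `A/B` at `a_i` is the
usual formula (`res`): `A(a_i)/C_i(a_i)` for a simple pole, `(A'(a_i)C_i(a_i) − A(a_i)C_i'(a_i))/C_i(a_i)²` for a double pole.
MAIN THEOREM `sum_res_eq_zero`: `deg A ≤ n − 2 ⇒ Σ_{i∈s} res_i(A) = 0`.
Proof (no analysis, no `RatFunc`): Mathlib's polynomial partial fractions `Polynomial.eq_quo_mul_prod_add_sum_rem_mul_prod`
give `A = q·B + Σ_i r_i·C_i` with `deg r_i < m_i`; `q = 0` by degrees (`div_modByMonic_unique`, `divByMonic_eq_zero_iff`);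
evaluating `A` (and `A'`) at `a_i` shows that `res_i(A)` is the coefficient of `X^{m_i−1}` in `r_i`, which is the coefficient of
`X^{n−1}` in `r_i·C_i` (`C_i` monic of degree `n − m_i`); summing, `Σ_i res_i(A) = coeff_{n−1}(A) = 0`.
Also recorded for the next file: the logarithmic-derivative evaluation `(∏ f_i)'(z) = ∏ f_i(z)·Σ f_i'(z)/f_i(z)` and
`((X − c)^k)'(z)/((X − c)^k)(z) = k/(z − c)`.
-/

open Finset Polynomial

namespace Summit.KontsevichZagierPeriods.Zeta5Search.PolynomialResidues

variable {K : Type*} [Field K] {ι : Type*}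

section LogDeriv

/-- Logarithmic derivative of a finite product, evaluated away from the zeros of the factors:
`(∏_{i∈t} f_i)'(z) = (∏_{i∈t} f_i(z)) · Σ_{i∈t} f_i'(z)/f_i(z)`. -/
theorem eval_derivative_prod [DecidableEq ι] (t : Finset ι) (f : ι → K[X]) (z : K)
    (hf : ∀ i ∈ t, (f i).eval z ≠ 0) :
    (derivative (∏ i ∈ t, f i)).eval z
      = (∏ i ∈ t, (f i).eval z) * ∑ i ∈ t, (derivative (f i)).eval z / (f i).eval z := by
  rw [derivative_prod_finset, eval_finsetSum, Finset.mul_sum]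
  refine Finset.sum_congr rfl fun i hi => ?_
  rw [eval_mul, eval_prod, ← Finset.mul_prod_erase t (fun k => (f k).eval z) hi]
  have h := hf i hi
  field_simp

/-- `((X − c)^k)'(z) / ((X − c)^k)(z) = k / (z − c)` for `z ≠ c` (also for `k = 0`). -/
theorem eval_derivative_pow_X_sub_C_div (c z : K) (k : ℕ) (hz : z - c ≠ 0) :
    (derivative ((X - C c) ^ k)).eval z / ((X - C c) ^ k).eval z = (k : K) / (z - c) := by
  rw [derivative_pow, derivative_X_sub_C, mul_one, eval_mul, eval_C, eval_pow, eval_pow, eval_sub, eval_X,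
    eval_C]
  rcases Nat.eq_zero_or_pos k with rfl | hk
  · simp
  · rw [div_eq_div_iff (pow_ne_zero _ hz) hz, mul_assoc, ← pow_succ, Nat.sub_add_cancel hk]

/-- Logarithmic derivative of a product of powers of linear factors at a non-root:
`(∏_{i∈t} (X − a_i)^{k_i})'(z) = (∏_{i∈t} (z − a_i)^{k_i}) · Σ_{i∈t} k_i/(z − a_i)`. -/
theorem eval_derivative_prod_pow_X_sub_C [DecidableEq ι] (t : Finset ι) (a : ι → K) (k : ι → ℕ) (z : K)
    (hz : ∀ i ∈ t, z - a i ≠ 0) :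
    (derivative (∏ i ∈ t, (X - C (a i)) ^ k i)).eval z
      = (∏ i ∈ t, (z - a i) ^ k i) * ∑ i ∈ t, (k i : K) / (z - a i) := by
  rw [eval_derivative_prod t _ z (fun i hi => by
    rw [eval_pow, eval_sub, eval_X, eval_C]; exact pow_ne_zero _ (hz i hi))]
  congr 1
  · refine Finset.prod_congr rfl fun i _ => ?_
    rw [eval_pow, eval_sub, eval_X, eval_C]
  · exact Finset.sum_congr rfl fun i hi => eval_derivative_pow_X_sub_C_div (a i) z (k i) (hz i hi)

/-- The product of powers of linear factors evaluates to the product of powers: `(∏ (X − a_i)^{k_i})(z) = ∏ (z − a_i)^{k_i}`. -/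
theorem eval_prod_pow_X_sub_C (t : Finset ι) (a : ι → K) (k : ι → ℕ) (z : K) :
    (∏ i ∈ t, (X - C (a i)) ^ k i).eval z = ∏ i ∈ t, (z - a i) ^ k i := by
  rw [eval_prod]
  exact Finset.prod_congr rfl fun i _ => by rw [eval_pow, eval_sub, eval_X, eval_C]

end LogDeriv

section Residues

variable [DecidableEq ι]

/-- The cofactor `C_i = ∏_{k ∈ s, k ≠ i} (X − a_k)^{m_k}` of the pole `a_i` in `B = ∏_{k∈s} (X − a_k)^{m_k}`. -/
noncomputable def cofactor (s : Finset ι) (a : ι → K) (m : ι → ℕ) (i : ι) : K[X] :=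
  ∏ k ∈ s.erase i, (X - C (a k)) ^ m k

/-- The residue of `A / ∏_{k∈s} (X − a_k)^{m_k}` at the pole `a_i` of order `m_i ∈ {1, 2}`:
`A(a_i)/C_i(a_i)` if `m_i = 1`, and `(A'(a_i)·C_i(a_i) − A(a_i)·C_i'(a_i)) / C_i(a_i)²` otherwise (double pole). -/
noncomputable def res (s : Finset ι) (a : ι → K) (m : ι → ℕ) (A : K[X]) (i : ι) : K :=
  if m i = 1 then A.eval (a i) / (cofactor s a m i).eval (a i)
  else ((derivative A).eval (a i) * (cofactor s a m i).eval (a i)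
      - A.eval (a i) * (derivative (cofactor s a m i)).eval (a i)) / (cofactor s a m i).eval (a i) ^ 2

/-- The cofactor is monic. -/
theorem cofactor_monic (s : Finset ι) (a : ι → K) (m : ι → ℕ) (i : ι) : (cofactor s a m i).Monic :=
  monic_prod_of_monic _ _ fun k _ => (monic_X_sub_C (a k)).pow (m k)

/-- Degree of the cofactor: `Σ_{k ∈ s, k ≠ i} m_k`. -/
theorem natDegree_cofactor (s : Finset ι) (a : ι → K) (m : ι → ℕ) (i : ι) :
    (cofactor s a m i).natDegree = ∑ k ∈ s.erase i, m k := by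
  unfold cofactor
  rw [natDegree_prod_of_monic _ _ (fun k _ => (monic_X_sub_C (a k)).pow (m k))]
  refine Finset.sum_congr rfl fun k _ => ?_
  rw [(monic_X_sub_C (a k)).natDegree_pow, natDegree_X_sub_C, mul_one]

/-- Value of the cofactor at a point. -/
theorem eval_cofactor (s : Finset ι) (a : ι → K) (m : ι → ℕ) (i : ι) (z : K) :
    (cofactor s a m i).eval z = ∏ k ∈ s.erase i, (z - a k) ^ m k :=
  eval_prod_pow_X_sub_C _ _ _ _

/-- The cofactor of `a_i` does not vanish at `a_i` (the points are distinct on `s`). -/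
theorem eval_cofactor_self_ne_zero (s : Finset ι) (a : ι → K) (m : ι → ℕ) (ha : Set.InjOn a s) {i : ι}
    (hi : i ∈ s) : (cofactor s a m i).eval (a i) ≠ 0 := by
  rw [eval_cofactor]
  refine Finset.prod_ne_zero_iff.2 fun k hk => pow_ne_zero _ (sub_ne_zero.2 ?_)
  obtain ⟨hki, hks⟩ := Finset.mem_erase.1 hk
  exact fun h => hki (ha hks hi h.symm)

/-- The cofactor of `a_i` vanishes at every other pole `a_j` (`j ∈ s`, `j ≠ i`, `m_j ≠ 0`). -/
theorem eval_cofactor_of_ne {s : Finset ι} {a : ι → K} {m : ι → ℕ} {i j : ι} (hj : j ∈ s) (hji : j ≠ i)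
    (hmj : m j ≠ 0) : (cofactor s a m i).eval (a j) = 0 := by
  rw [eval_cofactor]
  exact Finset.prod_eq_zero (Finset.mem_erase.2 ⟨hji, hj⟩) (by rw [sub_self, zero_pow hmj])

/-- A polynomial divisible by `(X − c)²` has vanishing derivative at `c`. -/
theorem eval_derivative_eq_zero_of_sq_mul (c : K) (p d : K[X]) (hp : p = (X - C c) ^ 2 * d) :
    (derivative p).eval c = 0 := by
  subst hp
  rw [derivative_mul, derivative_pow, derivative_X_sub_C]
  simp

/-- **Sum of residues.**  For distinct points `a_i` (`i ∈ s`), multiplicities `m_i ∈ {1,2}` and a polynomial `A` with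
`deg A + 2 ≤ Σ_{i∈s} m_i = deg ∏ (X − a_i)^{m_i}`, the residues of `A / ∏_{i∈s} (X − a_i)^{m_i}` at the points `a_i` sum to zero. -/
theorem sum_res_eq_zero (s : Finset ι) (a : ι → K) (m : ι → ℕ) (ha : Set.InjOn a s)
    (hm : ∀ i ∈ s, m i = 1 ∨ m i = 2) (A : K[X]) (hA : A.natDegree + 2 ≤ ∑ i ∈ s, m i) :
    ∑ i ∈ s, res s a m A i = 0 := by
  -- the monic, pairwise coprime system `g i = (X − a_i)^{m_i}` and Mathlib's polynomial partial fractions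
  have hmon : ∀ i ∈ s, ((fun i => (X - C (a i)) ^ m i) i).Monic := fun i _ => (monic_X_sub_C (a i)).pow (m i)
  have hcop : Set.Pairwise (s : Set ι) fun i j =>
      IsCoprime ((fun i => (X - C (a i)) ^ m i) i) ((fun i => (X - C (a i)) ^ m i) j) := by
    intro i hi j hj hij
    exact (isCoprime_X_sub_C_of_isUnit_sub (sub_ne_zero.2 fun h => hij (ha hi hj h)).isUnit).pow
  obtain ⟨q, r, hr, hArep⟩ := eq_quo_mul_prod_add_sum_rem_mul_prod A hmon hcop
  change A = q * (∏ i ∈ s, (X - C (a i)) ^ m i) + ∑ i ∈ s, r i * cofactor s a m i at hArep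
  -- degrees
  have hB : (∏ i ∈ s, (X - C (a i)) ^ m i).Monic := monic_prod_of_monic _ _ hmon
  have hBdeg : (∏ i ∈ s, (X - C (a i)) ^ m i).natDegree = ∑ i ∈ s, m i := by
    rw [natDegree_prod_of_monic _ _ hmon]
    refine Finset.sum_congr rfl fun i _ => ?_
    rw [(monic_X_sub_C (a i)).natDegree_pow, natDegree_X_sub_C, mul_one]
  have hmpos : ∀ i ∈ s, m i ≠ 0 := fun i hi => by rcases hm i hi with h | h <;> omega
  have hcofdeg : ∀ i ∈ s, (cofactor s a m i).natDegree + m i = ∑ k ∈ s, m k := by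
    intro i hi
    rw [natDegree_cofactor, Finset.sum_erase_add _ _ hi]
  have hrdeg : ∀ i ∈ s, (r i).natDegree < m i ∨ r i = 0 := by
    intro i hi
    by_cases h0 : r i = 0
    · exact Or.inr h0
    · left
      have h1 := natDegree_lt_natDegree h0 (hr i hi)
      rwa [(monic_X_sub_C (a i)).natDegree_pow, natDegree_X_sub_C, mul_one] at h1
  obtain ⟨n', hn'⟩ : ∃ n', ∑ i ∈ s, m i = n' + 2 := ⟨∑ i ∈ s, m i - 2, by omega⟩
  -- `q = 0`
  have hSdeg : (∑ i ∈ s, r i * cofactor s a m i).degree < (∏ i ∈ s, (X - C (a i)) ^ m i).degree := by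
    rw [degree_eq_natDegree hB.ne_zero, hBdeg]
    refine (degree_sum_le _ _).trans_lt ((Finset.sup_lt_iff (WithBot.bot_lt_coe _)).2 fun i hi => ?_)
    by_cases hri : r i = 0
    · rw [hri, zero_mul, degree_zero]
      exact WithBot.bot_lt_coe _
    · rw [degree_eq_natDegree (mul_ne_zero hri (cofactor_monic s a m i).ne_zero)]
      have h1 := natDegree_mul_le (p := r i) (q := cofactor s a m i)
      have h2 := hcofdeg i hi
      have h3 : (r i).natDegree < m i := (hrdeg i hi).resolve_right hri
      exact_mod_cast (show (r i * cofactor s a m i).natDegree < ∑ k ∈ s, m k by omega)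
  have hq : q = 0 := by
    have h1 := (div_modByMonic_unique (f := A) q (∑ i ∈ s, r i * cofactor s a m i) hB
      ⟨by rw [hArep]; ring, hSdeg⟩).1
    have h2 : A /ₘ (∏ i ∈ s, (X - C (a i)) ^ m i) = 0 := (divByMonic_eq_zero_iff hB).2 (by
      rw [degree_eq_natDegree hB.ne_zero, hBdeg]
      refine degree_le_natDegree.trans_lt ?_
      exact_mod_cast (show A.natDegree < ∑ k ∈ s, m k by omega))
    rw [h1] at h2
    exact h2
  have hA' : A = ∑ i ∈ s, r i * cofactor s a m i := by simpa [hq] using hArep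
  -- evaluation of `A` and `A'` at a pole
  have hevalA : ∀ i ∈ s, A.eval (a i) = (r i).eval (a i) * (cofactor s a m i).eval (a i) := by
    intro i hi
    rw [hA', eval_finsetSum, Finset.sum_eq_single_of_mem i hi (fun j hj hji => by
      rw [eval_mul, eval_cofactor_of_ne hi (Ne.symm hji) (hmpos i hi), mul_zero]), eval_mul]
  have hevalA' : ∀ i ∈ s, m i = 2 → (derivative A).eval (a i)
      = (derivative (r i)).eval (a i) * (cofactor s a m i).eval (a i)
        + (r i).eval (a i) * (derivative (cofactor s a m i)).eval (a i) := by
    intro i hi h2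
    rw [hA', derivative_sum, eval_finsetSum, Finset.sum_eq_single_of_mem i hi (fun j hj hji => ?_)]
    · rw [derivative_mul, eval_add, eval_mul, eval_mul]
    · have hmem : i ∈ s.erase j := Finset.mem_erase.2 ⟨Ne.symm hji, hi⟩
      refine eval_derivative_eq_zero_of_sq_mul (a i) _
        (r j * ∏ k ∈ (s.erase j).erase i, (X - C (a k)) ^ m k) ?_
      unfold cofactor
      rw [← Finset.mul_prod_erase _ _ hmem, h2]
      ring
  -- the coefficient of `X^{n−1}`
  have hcoeffA : A.coeff (n' + 1) = 0 := coeff_eq_zero_of_natDegree_lt (by omega)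
  have hsum : A.coeff (n' + 1) = ∑ i ∈ s, (r i * cofactor s a m i).coeff (n' + 1) := by
    conv_lhs => rw [hA']
    exact finsetSum_coeff _ _ _
  rw [← hcoeffA, hsum]
  refine Finset.sum_congr rfl fun i hi => ?_
  have hC0 := eval_cofactor_self_ne_zero s a m ha hi
  rcases hm i hi with h1 | h2
  · -- simple pole: `r i` is the constant `A(a_i)/C_i(a_i)`
    have hcdeg : (cofactor s a m i).natDegree = n' + 1 := by have := hcofdeg i hi; omega
    set c := (r i).coeff 0 with hc
    have hr1 : r i = C c := eq_C_of_natDegree_eq_zero (by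
      rcases hrdeg i hi with h | h
      · omega
      · simp [h])
    have hlead : (cofactor s a m i).coeff (n' + 1) = 1 := by
      rw [← hcdeg]; exact (cofactor_monic s a m i).coeff_natDegree
    rw [res, if_pos h1, hevalA i hi, hr1, eval_C, mul_div_cancel_right₀ _ hC0, coeff_C_mul, hlead, mul_one]
  · -- double pole: `r i = c₁ X + c₀` and the residue is `c₁`
    have hcdeg : (cofactor s a m i).natDegree = n' := by have := hcofdeg i hi; omega
    set c1 := (r i).coeff 1 with hc1
    set c0 := (r i).coeff 0 with hc0
    have hr2 : r i = C c1 * X + C c0 := eq_X_add_C_of_natDegree_le_one (by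
      rcases hrdeg i hi with h | h
      · omega
      · simp [h])
    have hlead : (cofactor s a m i).coeff n' = 1 := by
      rw [← hcdeg]; exact (cofactor_monic s a m i).coeff_natDegree
    have htop : (cofactor s a m i).coeff (n' + 1) = 0 := coeff_eq_zero_of_natDegree_lt (by omega)
    rw [res, if_neg (by omega), hevalA' i hi h2, hevalA i hi, hr2]
    simp only [derivative_add, derivative_mul, derivative_C, derivative_X, zero_mul, zero_add, mul_one, add_zero,
      eval_add, eval_mul, eval_C, eval_X, add_mul, coeff_add, mul_assoc, coeff_C_mul, coeff_X_mul, hlead, htop,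
      mul_zero]
    field_simp
    ring

/-- **Sum of residues = the coefficient at infinity (THEOREM R∞ form, no degree condition).**  For distinct points `a_i`
(`i ∈ s`) and multiplicities `m_i ∈ {1,2}`, with `B = ∏_{i∈s} (X − a_i)^{m_i}` of degree `n = Σ m_i`, the residues of `A/B` at the
points `a_i` sum to the coefficient of `X^{n−1}` in `A mod B` — i.e. to minus the residue at infinity of `(A mod B)/B`.  For
`deg A ≤ n − 2` this is `sum_res_eq_zero`. -/
theorem sum_res_eq_coeff_modByMonic (s : Finset ι) (a : ι → K) (m : ι → ℕ) (ha : Set.InjOn a s)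
    (hm : ∀ i ∈ s, m i = 1 ∨ m i = 2) (A : K[X]) :
    ∑ i ∈ s, res s a m A i
      = (A %ₘ ∏ i ∈ s, (X - C (a i)) ^ m i).coeff (∑ i ∈ s, m i - 1) := by
  -- the monic, pairwise coprime system `g i = (X − a_i)^{m_i}` and Mathlib's polynomial partial fractions
  have hmon : ∀ i ∈ s, ((fun i => (X - C (a i)) ^ m i) i).Monic := fun i _ => (monic_X_sub_C (a i)).pow (m i)
  have hcop : Set.Pairwise (s : Set ι) fun i j =>
      IsCoprime ((fun i => (X - C (a i)) ^ m i) i) ((fun i => (X - C (a i)) ^ m i) j) := by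
    intro i hi j hj hij
    exact (isCoprime_X_sub_C_of_isUnit_sub (sub_ne_zero.2 fun h => hij (ha hi hj h)).isUnit).pow
  obtain ⟨q, r, hr, hArep⟩ := eq_quo_mul_prod_add_sum_rem_mul_prod A hmon hcop
  change A = q * (∏ i ∈ s, (X - C (a i)) ^ m i) + ∑ i ∈ s, r i * cofactor s a m i at hArep
  -- degrees
  have hB : (∏ i ∈ s, (X - C (a i)) ^ m i).Monic := monic_prod_of_monic _ _ hmon
  have hBdeg : (∏ i ∈ s, (X - C (a i)) ^ m i).natDegree = ∑ i ∈ s, m i := by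
    rw [natDegree_prod_of_monic _ _ hmon]
    refine Finset.sum_congr rfl fun i _ => ?_
    rw [(monic_X_sub_C (a i)).natDegree_pow, natDegree_X_sub_C, mul_one]
  have hmpos : ∀ i ∈ s, m i ≠ 0 := fun i hi => by rcases hm i hi with h | h <;> omega
  have hcofdeg : ∀ i ∈ s, (cofactor s a m i).natDegree + m i = ∑ k ∈ s, m k := by
    intro i hi
    rw [natDegree_cofactor, Finset.sum_erase_add _ _ hi]
  have hrdeg : ∀ i ∈ s, (r i).natDegree < m i ∨ r i = 0 := by
    intro i hi
    by_cases h0 : r i = 0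
    · exact Or.inr h0
    · left
      have h1 := natDegree_lt_natDegree h0 (hr i hi)
      rwa [(monic_X_sub_C (a i)).natDegree_pow, natDegree_X_sub_C, mul_one] at h1
  -- `A mod B` is the partial-fraction numerator `Σ r_i C_i`
  have hSdeg : (∑ i ∈ s, r i * cofactor s a m i).degree < (∏ i ∈ s, (X - C (a i)) ^ m i).degree := by
    rw [degree_eq_natDegree hB.ne_zero, hBdeg]
    refine (degree_sum_le _ _).trans_lt ((Finset.sup_lt_iff (WithBot.bot_lt_coe _)).2 fun i hi => ?_)
    by_cases hri : r i = 0
    · rw [hri, zero_mul, degree_zero]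
      exact WithBot.bot_lt_coe _
    · rw [degree_eq_natDegree (mul_ne_zero hri (cofactor_monic s a m i).ne_zero)]
      have h1 := natDegree_mul_le (p := r i) (q := cofactor s a m i)
      have h2 := hcofdeg i hi
      have h3 : (r i).natDegree < m i := (hrdeg i hi).resolve_right hri
      exact_mod_cast (show (r i * cofactor s a m i).natDegree < ∑ k ∈ s, m k by omega)
  have hmod : A %ₘ (∏ i ∈ s, (X - C (a i)) ^ m i) = ∑ i ∈ s, r i * cofactor s a m i :=
    (div_modByMonic_unique (f := A) q (∑ i ∈ s, r i * cofactor s a m i) hB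
      ⟨by rw [hArep]; ring, hSdeg⟩).2
  -- the quotient part `q·B` is invisible at every pole: `B(a_i) = 0`, and `B'(a_i) = 0` at a double pole
  have hBeval : ∀ i ∈ s, (∏ k ∈ s, (X - C (a k)) ^ m k).eval (a i) = 0 := by
    intro i hi
    rw [eval_prod]
    exact Finset.prod_eq_zero hi (by rw [eval_pow, eval_sub, eval_X, eval_C, sub_self, zero_pow (hmpos i hi)])
  have hevalA : ∀ i ∈ s, A.eval (a i) = (r i).eval (a i) * (cofactor s a m i).eval (a i) := by
    intro i hi
    rw [hArep, eval_add, eval_mul, hBeval i hi, mul_zero, zero_add, eval_finsetSum,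
      Finset.sum_eq_single_of_mem i hi (fun j hj hji => by
        rw [eval_mul, eval_cofactor_of_ne hi (Ne.symm hji) (hmpos i hi), mul_zero]), eval_mul]
  have hevalA' : ∀ i ∈ s, m i = 2 → (derivative A).eval (a i)
      = (derivative (r i)).eval (a i) * (cofactor s a m i).eval (a i)
        + (r i).eval (a i) * (derivative (cofactor s a m i)).eval (a i) := by
    intro i hi h2
    have hqB : (derivative (q * ∏ k ∈ s, (X - C (a k)) ^ m k)).eval (a i) = 0 := by
      refine eval_derivative_eq_zero_of_sq_mul (a i) _ (q * ∏ k ∈ s.erase i, (X - C (a k)) ^ m k) ?_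
      rw [← Finset.mul_prod_erase _ _ hi, h2]
      ring
    rw [hArep, derivative_add, eval_add, hqB, zero_add, derivative_sum, eval_finsetSum,
      Finset.sum_eq_single_of_mem i hi (fun j hj hji => ?_)]
    · rw [derivative_mul, eval_add, eval_mul, eval_mul]
    · have hmem : i ∈ s.erase j := Finset.mem_erase.2 ⟨Ne.symm hji, hi⟩
      refine eval_derivative_eq_zero_of_sq_mul (a i) _
        (r j * ∏ k ∈ (s.erase j).erase i, (X - C (a k)) ^ m k) ?_
      unfold cofactor
      rw [← Finset.mul_prod_erase _ _ hmem, h2]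
      ring
  -- termwise: the residue at `a_i` is the top coefficient of `r_i`, i.e. of `r_i C_i`
  rw [hmod, finsetSum_coeff]
  refine Finset.sum_congr rfl fun i hi => ?_
  have hC0 := eval_cofactor_self_ne_zero s a m ha hi
  rcases hm i hi with h1 | h2
  · -- simple pole
    obtain ⟨n', hn'⟩ : ∃ n', ∑ k ∈ s, m k = n' + 1 := ⟨∑ k ∈ s, m k - 1, by have := hcofdeg i hi; omega⟩
    have hcdeg : (cofactor s a m i).natDegree = n' := by have := hcofdeg i hi; omega
    set c := (r i).coeff 0 with hc
    have hr1 : r i = C c := eq_C_of_natDegree_eq_zero (by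
      rcases hrdeg i hi with h | h
      · omega
      · simp [h])
    have hlead : (cofactor s a m i).coeff n' = 1 := by
      rw [← hcdeg]; exact (cofactor_monic s a m i).coeff_natDegree
    rw [hn', Nat.add_sub_cancel, res, if_pos h1, hevalA i hi, hr1, eval_C, mul_div_cancel_right₀ _ hC0, coeff_C_mul,
      hlead, mul_one]
  · -- double pole
    obtain ⟨n', hn'⟩ : ∃ n', ∑ k ∈ s, m k = n' + 2 := ⟨∑ k ∈ s, m k - 2, by have := hcofdeg i hi; omega⟩
    have hcdeg : (cofactor s a m i).natDegree = n' := by have := hcofdeg i hi; omega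
    set c1 := (r i).coeff 1 with hc1
    set c0 := (r i).coeff 0 with hc0
    have hr2 : r i = C c1 * X + C c0 := eq_X_add_C_of_natDegree_le_one (by
      rcases hrdeg i hi with h | h
      · omega
      · simp [h])
    have hlead : (cofactor s a m i).coeff n' = 1 := by
      rw [← hcdeg]; exact (cofactor_monic s a m i).coeff_natDegree
    have htop : (cofactor s a m i).coeff (n' + 1) = 0 := coeff_eq_zero_of_natDegree_lt (by omega)
    rw [hn', show n' + 2 - 1 = n' + 1 by omega, res, if_neg (by omega), hevalA' i hi h2, hevalA i hi, hr2]
    simp only [derivative_add, derivative_mul, derivative_C, derivative_X, zero_mul, zero_add, mul_one, add_zero,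
      eval_add, eval_mul, eval_C, eval_X, add_mul, coeff_add, mul_assoc, coeff_C_mul, coeff_X_mul, hlead, htop,
      mul_zero]
    field_simp
    ring

end Residues

end Summit.KontsevichZagierPeriods.Zeta5Search.PolynomialResidues
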